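import Literature.Analysis.FluidPDE.OseenSlice
import HarnessLib

/-!
# Hölder seminorm bounds for the Oseen slice operator `N_σ[a, b] = e^{σΔ} P ∇·(a ⊗ b)`

Analysis/FluidPDE support file (everything proved; no definitions, no named facts) on the
discharge path of the named fact
`Literature.Barriers.NavierStokesRegularity.CoiculescuPalasek2025_perturbation`
(`Barriers/NavierStokesRegularity/CriticalDataSmoothNonuniquenessConstruction.lean`: the
perturbation theorem, Props. 4.2–4.3 of M. P. Coiculescu, S. Palasek, Invent. Math. 244 (2025),
arXiv:2503.14699). The fixed point of its Prop. 4.3 lives in the space `X` with norm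
`sup_t (t^{1/2-α/2}‖V‖_{L^∞} + t^{1-α/2}‖∇V‖_{Ċ^κ})`, the residuals in `Y` with norm
`sup_t (t^{1-α}‖a‖_{L^∞} + t^{3/2-α}‖∇a‖_{Ċ^κ})`, and the semigroup bounds of Prop. 4.2 are driven by
the heat/Leray estimates (2.5) of its Lemma 2.2 in the two forms
`‖∇ e^{sΔ}P∇·G‖_{Ċ^κ} ≲ s^{-1/2}‖∇G‖_{Ċ^κ}` (derivatives and differences fall on the data) and
`‖∇ e^{sΔ}P∇·G‖_{Ċ^κ} ≲ s^{-1-κ/2}‖G‖_{L^∞}` (the kernel absorbs one derivative and a `κ`-fraction).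
This file proves these single-seminorm estimates for the tree's kernel realisation
`oseenSlice σ a b` of `e^{σΔ}P∇·(a ⊗ b)` on bounded fields of a finite-dimensional inner product
space (`OseenSlice.lean`; Koch–Nadirashvili–Seregin–Šverák 2009, §3 (3.12): "taking difference
quotients … we have similar estimates for spatial derivatives"), with the real-inequality
("one constant") phrasing of `OseenSliceHolder.lean`:

* `norm_sub_le_interpolate_fderiv` — the elementary interpolation
  `[f]_κ ≤ 2 ‖f‖_∞^{1-κ} ‖Df‖_∞^κ`, and `norm_fderiv_le_of_holder_fderiv` — the Landau-type
  inequality `‖Df(x)‖ ≤ 2‖f‖_∞/ρ + [Df]_κ ρ^κ` for every `ρ > 0` (mean value theorem on a segment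
  of length `ρ`);
* `oseenSlice_comp_add_right` — translation invariance `N_σ[a(· + h), b(· + h)](x) = N_σ[a, b](x + h)`;
* `exists_oseenSlice_holder_bounds` — one constant `C₀ = C₀(E)` with: the sup bound
  `‖N_σ[a,b]‖ ≤ C₀σ^{-1/2} M_a M_b` (the tree's `exists_norm_oseenSlice_le`); the **Hölder modulus**
  `‖N_σ[a,b](x) − N_σ[a,b](x')‖ ≤ C₀σ^{-1/2}(H_a M_b + M_a H_b)‖x − x'‖^κ` (differences fall on the
  data: `N[a,b](x'+h) − N[a,b](x') = N[a(·+h) − a, b(·+h)](x') + N[a, b(·+h) − b](x')`); the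
  **derivative sup bound** `‖D N_σ[a,b](x)‖ ≤ C₀σ^{-1/2}(D_a M_b + M_a D_b)` and the **Hölder
  modulus of the derivative**
  `‖DN_σ[a,b](x) − DN_σ[a,b](x')‖ ≤ C₀σ^{-1/2}(H_{Da}M_b + D_aH_b + H_aD_b + M_aH_{Db})‖x − x'‖^κ`
  for `C¹` data (the tree's `fderiv_oseenSlice_apply_of_contDiff`: `D(N[a,b])h = N[∂ₕa,b] + N[a,∂ₕb]`);
* `exists_norm_fderiv_oseenSlice_sub_le` — the **kernel form**
  `‖DN_σ[a,b](x) − DN_σ[a,b](x')‖ ≤ C σ^{-1-κ/2} M_a M_b ‖x − x'‖^κ` for merely bounded measurable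
  data, `κ ∈ [0, 1]` (interpolation between the tree's `‖DN_σ‖ ≤ C₁σ⁻¹M_aM_b` and
  `‖D²N_σ‖ ≤ C₂σ^{-3/2}M_aM_b`, `exists_norm_iteratedFDeriv_oseenSlice_le`).

## Mathlib / tree search

Tree: `oseenSlice`, `oseenSlice_eq_integral_sub`, `oseenSlice_sub_left/right`,
`integrable_oseenKernel_slice_of_bound`, `exists_norm_oseenSlice_le`, `contDiff_oseenSlice`,
`exists_norm_iteratedFDeriv_oseenSlice_le`, `exists_norm_fderiv_oseenSlice_le`,
`fderiv_oseenSlice_apply_of_contDiff` (`OseenSlice.lean`); the neighbouring `OseenSliceHolder.lean`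
proves the complementary *gain* `‖D^{k+1}N_σ‖ ≲ σ^{-1+α/2}` for `C^{k,α}` data, not the modulus of
`DN_σ` itself. Mathlib: `Convex.norm_image_sub_le_of_norm_fderiv_le`,
`norm_image_sub_le_of_norm_deriv_le_segment'`, `ContinuousLinearMap.opNorm_le_of_unit_norm`,
`norm_iteratedFDeriv_fderiv`.

## References

* M. P. Coiculescu, S. Palasek, Invent. Math. 244 (2025) = arXiv:2503.14699, §2.3 Lemma 2.2
  (2.5) and the proof of Prop. 4.2. [CoiculescuPalasek2025]
* G. Koch, N. Nadirashvili, G. Seregin, V. Šverák, Acta Math. 203 (2009) = arXiv:0709.3599v1,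
  §3 (3.12)–(3.13). [KochNadirashviliSereginSverak2009]
-/

noncomputable section

open MeasureTheory Set Function Filter Metric Real
open _root_.Topology
open scoped ENNReal NNReal RealInnerProductSpace ContDiff

namespace Literature.Analysis.FluidPDE

/-! ### Interpolation between a sup bound and a Hölder (or Lipschitz) modulus -/

section Interpolation

variable {V : Type*} [NormedAddCommGroup V] [NormedSpace ℝ V]
variable {F : Type*} [NormedAddCommGroup F] [NormedSpace ℝ F]

/-- `d ≤ A` and `d ≤ B` with `0 ≤ d` give `d ≤ A^{1-κ} B^κ` for `κ ∈ [0, 1]` (private copy of the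
tree's `le_rpow_mul_rpow_of_le_of_le`, `KNSSMildGradientBound.lean`, not imported). [folklore] -/
private theorem le_rpow_mul_rpow_of_le_of_le' {d A B κ : ℝ} (hd : 0 ≤ d) (hdA : d ≤ A) (hdB : d ≤ B)
    (hκ0 : 0 ≤ κ) (hκ1 : κ ≤ 1) : d ≤ A ^ (1 - κ) * B ^ κ := by
  have hA : 0 ≤ A := hd.trans hdA
  have heq : d = d ^ (1 - κ) * d ^ κ := by
    rw [← Real.rpow_add' hd (by norm_num : (1 - κ) + κ ≠ 0)]
    norm_num
  calc d = d ^ (1 - κ) * d ^ κ := heq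
    _ ≤ A ^ (1 - κ) * B ^ κ :=
        mul_le_mul (Real.rpow_le_rpow hd hdA (by linarith)) (Real.rpow_le_rpow hd hdB hκ0)
          (Real.rpow_nonneg hd _) (Real.rpow_nonneg hA _)

/-- **Interpolation `[f]_κ ≤ 2‖f‖_∞^{1-κ}‖Df‖_∞^κ`**: a differentiable `f` with `‖f‖ ≤ M₀` and
`‖Df‖ ≤ M₁` satisfies `‖f(x) − f(y)‖ ≤ 2 M₀^{1-κ} M₁^κ ‖x − y‖^κ` for `κ ∈ [0, 1]`
(`‖f(x) − f(y)‖ ≤ min(2M₀, M₁‖x − y‖)` by the mean value inequality, and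
`min(a, b) ≤ a^{1-κ}b^κ`, `2^{1-κ} ≤ 2`). [folklore] -/
theorem norm_sub_le_interpolate_fderiv {f : V → F} {M₀ M₁ κ : ℝ} (hκ0 : 0 ≤ κ) (hκ1 : κ ≤ 1)
    (hf : Differentiable ℝ f) (h0 : ∀ x, ‖f x‖ ≤ M₀) (h1 : ∀ x, ‖fderiv ℝ f x‖ ≤ M₁) (x y : V) :
    ‖f x - f y‖ ≤ 2 * M₀ ^ (1 - κ) * M₁ ^ κ * ‖x - y‖ ^ κ := by
  have hM₀ : 0 ≤ M₀ := (norm_nonneg _).trans (h0 x)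
  have hM₁ : 0 ≤ M₁ := (norm_nonneg _).trans (h1 x)
  have hd0 : 0 ≤ ‖f x - f y‖ := norm_nonneg _
  have hA : ‖f x - f y‖ ≤ 2 * M₀ := (norm_sub_le _ _).trans (by linarith [h0 x, h0 y])
  have hB : ‖f x - f y‖ ≤ M₁ * ‖x - y‖ :=
    (convex_univ).norm_image_sub_le_of_norm_fderiv_le (fun z _ => hf z) (fun z _ => h1 z)
      (mem_univ y) (mem_univ x)
  calc ‖f x - f y‖ ≤ (2 * M₀) ^ (1 - κ) * (M₁ * ‖x - y‖) ^ κ :=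
        le_rpow_mul_rpow_of_le_of_le' hd0 hA hB hκ0 hκ1
    _ = 2 ^ (1 - κ) * (M₀ ^ (1 - κ) * M₁ ^ κ * ‖x - y‖ ^ κ) := by
        rw [Real.mul_rpow (by norm_num) hM₀, Real.mul_rpow hM₁ (norm_nonneg _)]
        ring
    _ ≤ 2 * (M₀ ^ (1 - κ) * M₁ ^ κ * ‖x - y‖ ^ κ) := by
        have h2 : (2 : ℝ) ^ (1 - κ) ≤ 2 := by
          calc (2 : ℝ) ^ (1 - κ) ≤ 2 ^ (1 : ℝ) :=
                Real.rpow_le_rpow_of_exponent_le one_le_two (by linarith)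
            _ = 2 := Real.rpow_one 2
        exact mul_le_mul_of_nonneg_right h2 (by positivity)
    _ = 2 * M₀ ^ (1 - κ) * M₁ ^ κ * ‖x - y‖ ^ κ := by ring

/-- **Landau-type inequality `‖Df(x)‖ ≤ 2‖f‖_∞/ρ + [Df]_κ ρ^κ`** for every `ρ > 0`: a `C¹`
function with `‖f‖ ≤ M₀` whose derivative has the Hölder modulus `‖Df(x) − Df(y)‖ ≤ H‖x − y‖^κ`
obeys `‖Df(x)‖ ≤ 2M₀/ρ + Hρ^κ` (for a unit vector `v`,
`ρ Df(x)v = f(x + ρv) − f(x) − ∫₀^ρ (Df(x + sv) − Df(x))v ds`, the last term being at most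
`Hρ^{1+κ}` by the mean value inequality for `s ↦ f(x + sv) − s Df(x)v`). [folklore] -/
theorem norm_fderiv_le_of_holder_fderiv {f : V → F} {M₀ H κ ρ : ℝ} (hκ : 0 ≤ κ) (hρ : 0 < ρ)
    (hH0 : 0 ≤ H) (hf : ContDiff ℝ 1 f) (h0 : ∀ x, ‖f x‖ ≤ M₀)
    (hH : ∀ x y, ‖fderiv ℝ f x - fderiv ℝ f y‖ ≤ H * ‖x - y‖ ^ κ) (x : V) :
    ‖fderiv ℝ f x‖ ≤ 2 * M₀ / ρ + H * ρ ^ κ := by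
  have hM₀ : 0 ≤ M₀ := (norm_nonneg _).trans (h0 x)
  have hdiff : Differentiable ℝ f := hf.differentiable one_ne_zero
  refine ContinuousLinearMap.opNorm_le_of_unit_norm (by positivity) fun v hv => ?_
  -- the auxiliary function `φ(s) = f(x + s v) − s Df(x) v` on `[0, ρ]`
  set φ : ℝ → F := fun s => f (x + s • v) - s • fderiv ℝ f x v with hφ
  have hderiv : ∀ s ∈ Icc (0 : ℝ) ρ,
      HasDerivWithinAt φ (fderiv ℝ f (x + s • v) v - fderiv ℝ f x v) (Icc 0 ρ) s := by
    intro s _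
    have hγ : HasDerivAt (fun s : ℝ => x + s • v) v s := by
      simpa using ((hasDerivAt_id s).smul_const v).const_add x
    have h1 : HasDerivAt (fun s : ℝ => f (x + s • v)) (fderiv ℝ f (x + s • v) v) s :=
      (hdiff (x + s • v)).hasFDerivAt.comp_hasDerivAt s hγ
    have h2 : HasDerivAt (fun s : ℝ => s • fderiv ℝ f x v) (fderiv ℝ f x v) s := by
      simpa using (hasDerivAt_id s).smul_const (fderiv ℝ f x v)
    exact (h1.sub h2).hasDerivWithinAt
  have hbound : ∀ s ∈ Ico (0 : ℝ) ρ,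
      ‖fderiv ℝ f (x + s • v) v - fderiv ℝ f x v‖ ≤ H * ρ ^ κ := by
    intro s hs
    calc ‖fderiv ℝ f (x + s • v) v - fderiv ℝ f x v‖
        = ‖(fderiv ℝ f (x + s • v) - fderiv ℝ f x) v‖ := by
          simp only [FunLike.coe_sub, Pi.sub_apply]
      _ ≤ ‖fderiv ℝ f (x + s • v) - fderiv ℝ f x‖ * ‖v‖ := ContinuousLinearMap.le_opNorm _ _
      _ ≤ H * ‖(x + s • v) - x‖ ^ κ * ‖v‖ :=
          mul_le_mul_of_nonneg_right (hH _ _) (norm_nonneg _)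
      _ = H * s ^ κ := by
          rw [add_sub_cancel_left, norm_smul, hv, mul_one, Real.norm_of_nonneg hs.1, mul_one]
      _ ≤ H * ρ ^ κ := mul_le_mul_of_nonneg_left (Real.rpow_le_rpow hs.1 hs.2.le hκ) hH0
  have hmv := norm_image_sub_le_of_norm_deriv_le_segment' hderiv hbound ρ
    (right_mem_Icc.2 hρ.le)
  have hkey : ρ * ‖fderiv ℝ f x v‖ ≤ 2 * M₀ + H * ρ ^ κ * ρ := by
    have heq : ρ • fderiv ℝ f x v = (f (x + ρ • v) - f x) - (φ ρ - φ 0) := by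
      simp only [hφ, zero_smul, add_zero, sub_zero]
      abel
    have h1 : ‖ρ • fderiv ℝ f x v‖ ≤ 2 * M₀ + H * ρ ^ κ * ρ := by
      rw [heq]
      calc ‖(f (x + ρ • v) - f x) - (φ ρ - φ 0)‖
          ≤ ‖f (x + ρ • v) - f x‖ + ‖φ ρ - φ 0‖ := norm_sub_le _ _
        _ ≤ (M₀ + M₀) + H * ρ ^ κ * (ρ - 0) :=
            add_le_add ((norm_sub_le _ _).trans (add_le_add (h0 _) (h0 _))) hmv
        _ = 2 * M₀ + H * ρ ^ κ * ρ := by ring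
    rwa [norm_smul, Real.norm_of_nonneg hρ.le] at h1
  have h2 : ‖fderiv ℝ f x v‖ ≤ (2 * M₀ + H * ρ ^ κ * ρ) / ρ := by
    rw [le_div_iff₀ hρ]
    linarith
  calc ‖fderiv ℝ f x v‖ ≤ (2 * M₀ + H * ρ ^ κ * ρ) / ρ := h2
    _ = 2 * M₀ / ρ + H * ρ ^ κ := by field_simp

end Interpolation

/-! ### Hölder bounds for the slice operator -/

section Slice

variable {E : Type*} [NormedAddCommGroup E] [InnerProductSpace ℝ E] [FiniteDimensional ℝ E]
  [MeasurableSpace E] [BorelSpace E]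

/-- **Translation invariance of the slice operator**: `N_σ[a(· + h), b(· + h)](x) = N_σ[a, b](x + h)`
(`N_σ[a, b](x) = ∫ K(σ, z)[a(x − z), b(x − z)] dz`, `oseenSlice_eq_integral_sub`). [folklore] -/
theorem oseenSlice_comp_add_right (σ : ℝ) (a b : E → E) (h x : E) :
    oseenSlice σ (fun y => a (y + h)) (fun y => b (y + h)) x = oseenSlice σ a b (x + h) := by
  rw [oseenSlice_eq_integral_sub, oseenSlice_eq_integral_sub]
  refine integral_congr_ae (Eventually.of_forall fun z => ?_)
  simp only [sub_add_eq_add_sub]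

/-- **Hölder bounds for the Oseen slice operator with one constant `C₀ = C₀(E)`** (differences and
derivatives fall on the data; KNSS 2009, (3.12)–(3.13); Coiculescu–Palasek 2025, Lemma 2.2
(2.5), first form). For `σ > 0`:
1. `‖N_σ[a, b](x)‖ ≤ C₀ σ^{-1/2} M_a M_b` for fields bounded by `M_a`, `M_b` (the tree's
   `exists_norm_oseenSlice_le`);
2. `‖N_σ[a,b](x) − N_σ[a,b](x')‖ ≤ C₀ σ^{-1/2} (H_a M_b + M_a H_b) ‖x − x'‖^κ` for bounded measurable
   fields with `‖a(y) − a(y')‖ ≤ H_a‖y − y'‖^κ`, `‖b(y) − b(y')‖ ≤ H_b‖y − y'‖^κ`;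
3. `‖D N_σ[a,b](x)‖ ≤ C₀ σ^{-1/2} (D_a M_b + M_a D_b)` for bounded `C¹` fields with
   `‖Da‖ ≤ D_a`, `‖Db‖ ≤ D_b`;
4. `‖DN_σ[a,b](x) − DN_σ[a,b](x')‖ ≤ C₀ σ^{-1/2} (H_{Da} M_b + D_a H_b + H_a D_b + M_a H_{Db}) ‖x − x'‖^κ`
   for bounded `C¹` fields with bounded, `κ`-Hölder derivatives
   (`‖Da(y) − Da(y')‖ ≤ H_{Da}‖y − y'‖^κ`, …).
[cite: KochNadirashviliSereginSverak2009, (3.12)–(3.13) (arXiv:0709.3599v1 p. 6)] -/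
theorem exists_oseenSlice_holder_bounds :
    ∃ C₀ : ℝ, 0 < C₀ ∧
      (∀ {σ : ℝ}, 0 < σ → ∀ {a b : E → E} {Ma Mb : ℝ},
        (∀ y, ‖a y‖ ≤ Ma) → (∀ y, ‖b y‖ ≤ Mb) → ∀ x,
          ‖oseenSlice σ a b x‖ ≤ C₀ * σ ^ (-(1 / 2 : ℝ)) * Ma * Mb) ∧
      (∀ {σ : ℝ}, 0 < σ → ∀ {a b : E → E} {Ma Mb Ha Hb κ : ℝ},
        Measurable a → Measurable b → (∀ y, ‖a y‖ ≤ Ma) → (∀ y, ‖b y‖ ≤ Mb) →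
        (∀ y y', ‖a y - a y'‖ ≤ Ha * ‖y - y'‖ ^ κ) → (∀ y y', ‖b y - b y'‖ ≤ Hb * ‖y - y'‖ ^ κ) →
        ∀ x x', ‖oseenSlice σ a b x - oseenSlice σ a b x'‖ ≤
          C₀ * σ ^ (-(1 / 2 : ℝ)) * (Ha * Mb + Ma * Hb) * ‖x - x'‖ ^ κ) ∧
      (∀ {σ : ℝ}, 0 < σ → ∀ {a b : E → E} {Ma Mb Da Db : ℝ},
        ContDiff ℝ 1 a → ContDiff ℝ 1 b → (∀ y, ‖a y‖ ≤ Ma) → (∀ y, ‖b y‖ ≤ Mb) →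
        (∀ y, ‖fderiv ℝ a y‖ ≤ Da) → (∀ y, ‖fderiv ℝ b y‖ ≤ Db) → ∀ x,
          ‖fderiv ℝ (oseenSlice σ a b) x‖ ≤ C₀ * σ ^ (-(1 / 2 : ℝ)) * (Da * Mb + Ma * Db)) ∧
      (∀ {σ : ℝ}, 0 < σ → ∀ {a b : E → E} {Ma Mb Da Db Ha Hb HDa HDb κ : ℝ},
        ContDiff ℝ 1 a → ContDiff ℝ 1 b → (∀ y, ‖a y‖ ≤ Ma) → (∀ y, ‖b y‖ ≤ Mb) →
        (∀ y, ‖fderiv ℝ a y‖ ≤ Da) → (∀ y, ‖fderiv ℝ b y‖ ≤ Db) →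
        (∀ y y', ‖a y - a y'‖ ≤ Ha * ‖y - y'‖ ^ κ) → (∀ y y', ‖b y - b y'‖ ≤ Hb * ‖y - y'‖ ^ κ) →
        (∀ y y', ‖fderiv ℝ a y - fderiv ℝ a y'‖ ≤ HDa * ‖y - y'‖ ^ κ) →
        (∀ y y', ‖fderiv ℝ b y - fderiv ℝ b y'‖ ≤ HDb * ‖y - y'‖ ^ κ) →
        ∀ x x' v, ‖fderiv ℝ (oseenSlice σ a b) x v - fderiv ℝ (oseenSlice σ a b) x' v‖ ≤
          C₀ * σ ^ (-(1 / 2 : ℝ)) * (HDa * Mb + Da * Hb + Ha * Db + Ma * HDb) * ‖x - x'‖ ^ κ *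
            ‖v‖) := by
  obtain ⟨C₀, hC₀, hN⟩ := exists_norm_oseenSlice_le (E := E)
  -- 2. the Hölder modulus
  have hHol : ∀ {σ : ℝ}, 0 < σ → ∀ {a b : E → E} {Ma Mb Ha Hb κ : ℝ},
      Measurable a → Measurable b → (∀ y, ‖a y‖ ≤ Ma) → (∀ y, ‖b y‖ ≤ Mb) →
      (∀ y y', ‖a y - a y'‖ ≤ Ha * ‖y - y'‖ ^ κ) → (∀ y y', ‖b y - b y'‖ ≤ Hb * ‖y - y'‖ ^ κ) →
      ∀ x x', ‖oseenSlice σ a b x - oseenSlice σ a b x'‖ ≤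
        C₀ * σ ^ (-(1 / 2 : ℝ)) * (Ha * Mb + Ma * Hb) * ‖x - x'‖ ^ κ := by
    intro σ hσ a b Ma Mb Ha Hb κ ham hbm ha hb hHa hHb x x'
    set h : E := x - x' with hh
    have hx : x = x' + h := by rw [hh]; abel
    set ah : E → E := fun y => a (y + h) with hah
    set bh : E → E := fun y => b (y + h) with hbh
    have hahm : Measurable ah := ham.comp (measurable_id.add_const h)
    have hbhm : Measurable bh := hbm.comp (measurable_id.add_const h)
    have hahb : ∀ y, ‖ah y‖ ≤ Ma := fun y => ha _
    have hbhb : ∀ y, ‖bh y‖ ≤ Mb := fun y => hb _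
    have hda : ∀ y, ‖(ah - a) y‖ ≤ Ha * ‖h‖ ^ κ := fun y => by
      have := hHa (y + h) y
      rwa [add_sub_cancel_left] at this
    have hdb : ∀ y, ‖(bh - b) y‖ ≤ Hb * ‖h‖ ^ κ := fun y => by
      have := hHb (y + h) y
      rwa [add_sub_cancel_left] at this
    have i1 := integrable_oseenKernel_slice_of_bound hσ hahm.aestronglyMeasurable
      hbhm.aestronglyMeasurable hahb hbhb x'
    have i2 := integrable_oseenKernel_slice_of_bound hσ ham.aestronglyMeasurable
      hbhm.aestronglyMeasurable ha hbhb x'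
    have i3 := integrable_oseenKernel_slice_of_bound hσ ham.aestronglyMeasurable
      hbm.aestronglyMeasurable ha hb x'
    have key : oseenSlice σ a b x - oseenSlice σ a b x' =
        oseenSlice σ (ah - a) bh x' + oseenSlice σ a (bh - b) x' := by
      rw [hx, ← oseenSlice_comp_add_right σ a b h x', oseenSlice_sub_left i1 i2,
        oseenSlice_sub_right i2 i3]
      abel
    rw [key]
    calc ‖oseenSlice σ (ah - a) bh x' + oseenSlice σ a (bh - b) x'‖
        ≤ ‖oseenSlice σ (ah - a) bh x'‖ + ‖oseenSlice σ a (bh - b) x'‖ := norm_add_le _ _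
      _ ≤ C₀ * σ ^ (-(1 / 2 : ℝ)) * (Ha * ‖h‖ ^ κ) * Mb +
            C₀ * σ ^ (-(1 / 2 : ℝ)) * Ma * (Hb * ‖h‖ ^ κ) :=
          add_le_add (hN hσ hda hbhb x') (hN hσ ha hdb x')
      _ = C₀ * σ ^ (-(1 / 2 : ℝ)) * (Ha * Mb + Ma * Hb) * ‖h‖ ^ κ := by ring
  refine ⟨C₀, hC₀, fun hσ _ _ _ _ ha hb x => hN hσ ha hb x, hHol, ?_, ?_⟩
  · -- 3. the derivative sup bound
    intro σ hσ a b Ma Mb Da Db ha1 hb1 ha hb hDa hDb x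
    have hMa : 0 ≤ Ma := (norm_nonneg _).trans (ha x)
    have hMb : 0 ≤ Mb := (norm_nonneg _).trans (hb x)
    have hDa0 : 0 ≤ Da := (norm_nonneg _).trans (hDa x)
    have hDb0 : 0 ≤ Db := (norm_nonneg _).trans (hDb x)
    have hσ' : 0 ≤ σ ^ (-(1 / 2 : ℝ)) := Real.rpow_nonneg hσ.le _
    refine ContinuousLinearMap.opNorm_le_bound _ (by positivity) fun v => ?_
    rw [fderiv_oseenSlice_apply_of_contDiff hσ ha1 hb1 ha hb hDa hDb x v]
    have hav : ∀ y, ‖fderiv ℝ a y v‖ ≤ Da * ‖v‖ := fun y =>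
      (ContinuousLinearMap.le_opNorm _ _).trans (mul_le_mul_of_nonneg_right (hDa y) (norm_nonneg _))
    have hbv : ∀ y, ‖fderiv ℝ b y v‖ ≤ Db * ‖v‖ := fun y =>
      (ContinuousLinearMap.le_opNorm _ _).trans (mul_le_mul_of_nonneg_right (hDb y) (norm_nonneg _))
    calc ‖oseenSlice σ (fun y => fderiv ℝ a y v) b x + oseenSlice σ a (fun y => fderiv ℝ b y v) x‖
        ≤ ‖oseenSlice σ (fun y => fderiv ℝ a y v) b x‖ +
            ‖oseenSlice σ a (fun y => fderiv ℝ b y v) x‖ := norm_add_le _ _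
      _ ≤ C₀ * σ ^ (-(1 / 2 : ℝ)) * (Da * ‖v‖) * Mb + C₀ * σ ^ (-(1 / 2 : ℝ)) * Ma * (Db * ‖v‖) :=
          add_le_add (hN hσ hav hb x) (hN hσ ha hbv x)
      _ = C₀ * σ ^ (-(1 / 2 : ℝ)) * (Da * Mb + Ma * Db) * ‖v‖ := by ring
  · -- 4. the Hölder modulus of the derivative, in each direction `v`
    intro σ hσ a b Ma Mb Da Db Ha Hb HDa HDb κ ha1 hb1 ha hb hDa hDb hHa hHb hHDa hHDb x x' v
    have hcont_a : Continuous fun y => fderiv ℝ a y := ha1.continuous_fderiv one_ne_zero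
    have hcont_b : Continuous fun y => fderiv ℝ b y := hb1.continuous_fderiv one_ne_zero
    have hav : ∀ y, ‖fderiv ℝ a y v‖ ≤ Da * ‖v‖ := fun y =>
      (ContinuousLinearMap.le_opNorm _ _).trans
        (mul_le_mul_of_nonneg_right (hDa y) (norm_nonneg _))
    have hbv : ∀ y, ‖fderiv ℝ b y v‖ ≤ Db * ‖v‖ := fun y =>
      (ContinuousLinearMap.le_opNorm _ _).trans
        (mul_le_mul_of_nonneg_right (hDb y) (norm_nonneg _))
    have hHav : ∀ y y', ‖fderiv ℝ a y v - fderiv ℝ a y' v‖ ≤ HDa * ‖v‖ * ‖y - y'‖ ^ κ :=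
      fun y y' => by
      rw [show fderiv ℝ a y v - fderiv ℝ a y' v = (fderiv ℝ a y - fderiv ℝ a y') v from by
        simp only [FunLike.coe_sub, Pi.sub_apply]]
      refine (ContinuousLinearMap.le_opNorm _ _).trans ?_
      calc ‖fderiv ℝ a y - fderiv ℝ a y'‖ * ‖v‖ ≤ HDa * ‖y - y'‖ ^ κ * ‖v‖ :=
            mul_le_mul_of_nonneg_right (hHDa y y') (norm_nonneg _)
        _ = HDa * ‖v‖ * ‖y - y'‖ ^ κ := by ring
    have hHbv : ∀ y y', ‖fderiv ℝ b y v - fderiv ℝ b y' v‖ ≤ HDb * ‖v‖ * ‖y - y'‖ ^ κ :=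
      fun y y' => by
      rw [show fderiv ℝ b y v - fderiv ℝ b y' v = (fderiv ℝ b y - fderiv ℝ b y') v from by
        simp only [FunLike.coe_sub, Pi.sub_apply]]
      refine (ContinuousLinearMap.le_opNorm _ _).trans ?_
      calc ‖fderiv ℝ b y - fderiv ℝ b y'‖ * ‖v‖ ≤ HDb * ‖y - y'‖ ^ κ * ‖v‖ :=
            mul_le_mul_of_nonneg_right (hHDb y y') (norm_nonneg _)
        _ = HDb * ‖v‖ * ‖y - y'‖ ^ κ := by ring
    have h1 := hHol hσ (hcont_a.clm_apply continuous_const).measurable hb1.continuous.measurable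
      hav hb hHav hHb x x'
    have h2 := hHol hσ ha1.continuous.measurable (hcont_b.clm_apply continuous_const).measurable
      ha hbv hHa hHbv x x'
    rw [fderiv_oseenSlice_apply_of_contDiff hσ ha1 hb1 ha hb hDa hDb x v,
      fderiv_oseenSlice_apply_of_contDiff hσ ha1 hb1 ha hb hDa hDb x' v]
    calc ‖oseenSlice σ (fun y => fderiv ℝ a y v) b x + oseenSlice σ a (fun y => fderiv ℝ b y v) x -
          (oseenSlice σ (fun y => fderiv ℝ a y v) b x' +
            oseenSlice σ a (fun y => fderiv ℝ b y v) x')‖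
        = ‖(oseenSlice σ (fun y => fderiv ℝ a y v) b x - oseenSlice σ (fun y => fderiv ℝ a y v) b x') +
            (oseenSlice σ a (fun y => fderiv ℝ b y v) x -
              oseenSlice σ a (fun y => fderiv ℝ b y v) x')‖ := by
          congr 1
          abel
      _ ≤ ‖oseenSlice σ (fun y => fderiv ℝ a y v) b x - oseenSlice σ (fun y => fderiv ℝ a y v) b x'‖ +
            ‖oseenSlice σ a (fun y => fderiv ℝ b y v) x -
              oseenSlice σ a (fun y => fderiv ℝ b y v) x'‖ := norm_add_le _ _
      _ ≤ C₀ * σ ^ (-(1 / 2 : ℝ)) * (HDa * ‖v‖ * Mb + Da * ‖v‖ * Hb) * ‖x - x'‖ ^ κ +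
            C₀ * σ ^ (-(1 / 2 : ℝ)) * (Ha * (Db * ‖v‖) + Ma * (HDb * ‖v‖)) * ‖x - x'‖ ^ κ :=
          add_le_add h1 h2
      _ = C₀ * σ ^ (-(1 / 2 : ℝ)) * (HDa * Mb + Da * Hb + Ha * Db + Ma * HDb) * ‖x - x'‖ ^ κ *
            ‖v‖ := by ring

/-- **Kernel form of the Hölder modulus of the derivative** (Coiculescu–Palasek 2025, (2.5) in
the form `‖∇e^{sΔ}P∇·G‖_{Ċ^κ} ≲ s^{-1-κ/2}‖G‖_{L^∞}`): there is `C = C(E) ≥ 0` such that for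
`σ > 0`, `κ ∈ [0, 1]` and bounded measurable fields `a, b` (bounds `M_a, M_b`),
`‖DN_σ[a,b](x) − DN_σ[a,b](x')‖ ≤ C σ^{-1-κ/2} M_a M_b ‖x − x'‖^κ` — interpolation
(`norm_sub_le_interpolate_fderiv`) between the tree's first- and second-order sup bounds
`‖DN_σ[a,b]‖ ≤ C₁σ⁻¹M_aM_b`, `‖D²N_σ[a,b]‖ ≤ C₂σ^{-3/2}M_aM_b`
(`exists_norm_iteratedFDeriv_oseenSlice_le`). [cite: CoiculescuPalasek2025, §2.3 Lemma 2.2 (2.5)] -/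
theorem exists_norm_fderiv_oseenSlice_sub_le :
    ∃ C : ℝ, 0 ≤ C ∧ ∀ {σ κ : ℝ}, 0 < σ → 0 ≤ κ → κ ≤ 1 → ∀ {a b : E → E} {Ma Mb : ℝ},
      Measurable a → Measurable b → (∀ y, ‖a y‖ ≤ Ma) → (∀ y, ‖b y‖ ≤ Mb) → ∀ x x',
        ‖fderiv ℝ (oseenSlice σ a b) x - fderiv ℝ (oseenSlice σ a b) x'‖ ≤
          C * σ ^ (-1 - κ / 2) * Ma * Mb * ‖x - x'‖ ^ κ := by
  obtain ⟨C₁, hC₁, h1⟩ := exists_norm_iteratedFDeriv_oseenSlice_le (E := E) 1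
  obtain ⟨C₂, hC₂, h2⟩ := exists_norm_iteratedFDeriv_oseenSlice_le (E := E) 2
  set K : ℝ := max C₁ C₂ with hK
  have hK0 : 0 ≤ K := le_max_of_le_left hC₁
  refine ⟨2 * K, by positivity, fun {σ κ} hσ hκ0 hκ1 {a b Ma Mb} ham hbm ha hb x x' => ?_⟩
  have hMa : 0 ≤ Ma := (norm_nonneg _).trans (ha x)
  have hMb : 0 ≤ Mb := (norm_nonneg _).trans (hb x)
  set P : ℝ := Ma * Mb with hP
  have hP0 : 0 ≤ P := mul_nonneg hMa hMb
  -- smoothness and the two sup bounds for `f = D N_σ[a, b]`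
  have hsm : ContDiff ℝ 2 (oseenSlice σ a b) := contDiff_oseenSlice hσ ham hbm ha hb
  have hdf : Differentiable ℝ (fderiv ℝ (oseenSlice σ a b)) :=
    (hsm.fderiv_right (m := 1) (by norm_num)).differentiable one_ne_zero
  have hb1 : ∀ y, ‖fderiv ℝ (oseenSlice σ a b) y‖ ≤ C₁ * σ ^ (-(1 : ℝ)) * P := fun y => by
    have h := h1 hσ ham hbm ha hb y
    rw [norm_iteratedFDeriv_one] at h
    have he : (-((1 : ℕ) + 1 : ℝ) / 2) = -(1 : ℝ) := by norm_num
    rw [he] at h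
    calc ‖fderiv ℝ (oseenSlice σ a b) y‖ ≤ C₁ * σ ^ (-(1 : ℝ)) * Ma * Mb := h
      _ = C₁ * σ ^ (-(1 : ℝ)) * P := by rw [hP]; ring
  have hb2 : ∀ y, ‖fderiv ℝ (fderiv ℝ (oseenSlice σ a b)) y‖ ≤ C₂ * σ ^ (-(3 / 2 : ℝ)) * P :=
    fun y => by
    have h := h2 hσ ham hbm ha hb y
    rw [← norm_iteratedFDeriv_fderiv, norm_iteratedFDeriv_one] at h
    have he : (-((2 : ℕ) + 1 : ℝ) / 2) = -(3 / 2 : ℝ) := by norm_num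
    rw [he] at h
    calc ‖fderiv ℝ (fderiv ℝ (oseenSlice σ a b)) y‖ ≤ C₂ * σ ^ (-(3 / 2 : ℝ)) * Ma * Mb := h
      _ = C₂ * σ ^ (-(3 / 2 : ℝ)) * P := by rw [hP]; ring
  have hint := norm_sub_le_interpolate_fderiv hκ0 hκ1 hdf hb1 hb2 x x'
  refine hint.trans ?_
  -- `2 (C₁σ⁻¹P)^{1-κ} (C₂σ^{-3/2}P)^κ ≤ 2 K σ^{-1-κ/2} P`
  have hσ0 : 0 ≤ σ := hσ.le
  have hs1 : 0 ≤ σ ^ (-(1 : ℝ)) := Real.rpow_nonneg hσ0 _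
  have hs2 : 0 ≤ σ ^ (-(3 / 2 : ℝ)) := Real.rpow_nonneg hσ0 _
  have hx : 0 ≤ ‖x - x'‖ ^ κ := Real.rpow_nonneg (norm_nonneg _) _
  have e1 : (C₁ * σ ^ (-(1 : ℝ)) * P) ^ (1 - κ) ≤ (K * σ ^ (-(1 : ℝ)) * P) ^ (1 - κ) :=
    Real.rpow_le_rpow (by positivity) (by gcongr; exact le_max_left _ _) (by linarith)
  have e2 : (C₂ * σ ^ (-(3 / 2 : ℝ)) * P) ^ κ ≤ (K * σ ^ (-(3 / 2 : ℝ)) * P) ^ κ :=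
    Real.rpow_le_rpow (by positivity) (by gcongr; exact le_max_right _ _) hκ0
  have e3 : (K * σ ^ (-(1 : ℝ)) * P) ^ (1 - κ) * (K * σ ^ (-(3 / 2 : ℝ)) * P) ^ κ =
      K * σ ^ (-1 - κ / 2) * P := by
    rw [Real.mul_rpow (by positivity) hP0, Real.mul_rpow hK0 hs1,
      Real.mul_rpow (by positivity) hP0, Real.mul_rpow hK0 hs2, ← Real.rpow_mul hσ0,
      ← Real.rpow_mul hσ0]
    have hKK : K ^ (1 - κ) * K ^ κ = K := by
      rw [← Real.rpow_add' hK0 (by norm_num : (1 - κ) + κ ≠ 0)]; norm_num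
    have hPP : P ^ (1 - κ) * P ^ κ = P := by
      rw [← Real.rpow_add' hP0 (by norm_num : (1 - κ) + κ ≠ 0)]; norm_num
    have hss : σ ^ (-(1 : ℝ) * (1 - κ)) * σ ^ (-(3 / 2 : ℝ) * κ) = σ ^ (-1 - κ / 2) := by
      rw [← Real.rpow_add hσ]; congr 1; ring
    calc K ^ (1 - κ) * σ ^ (-(1 : ℝ) * (1 - κ)) * P ^ (1 - κ) *
          (K ^ κ * σ ^ (-(3 / 2 : ℝ) * κ) * P ^ κ)
        = (K ^ (1 - κ) * K ^ κ) * (σ ^ (-(1 : ℝ) * (1 - κ)) * σ ^ (-(3 / 2 : ℝ) * κ)) *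
            (P ^ (1 - κ) * P ^ κ) := by ring
      _ = K * σ ^ (-1 - κ / 2) * P := by rw [hKK, hPP, hss]
  calc 2 * (C₁ * σ ^ (-(1 : ℝ)) * P) ^ (1 - κ) * (C₂ * σ ^ (-(3 / 2 : ℝ)) * P) ^ κ * ‖x - x'‖ ^ κ
      ≤ 2 * (K * σ ^ (-(1 : ℝ)) * P) ^ (1 - κ) * (K * σ ^ (-(3 / 2 : ℝ)) * P) ^ κ * ‖x - x'‖ ^ κ := by
        gcongr
    _ = 2 * K * σ ^ (-1 - κ / 2) * Ma * Mb * ‖x - x'‖ ^ κ := by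
        rw [mul_assoc 2, e3, hP]; ring

end Slice

end Literature.Analysis.FluidPDE
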